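import Mathlib
import Summits.AtomisticToContinuum.Crystallization.Theses.PhononSlackCertificates
import Summits.AtomisticToContinuum.Crystallization.Theorems.PhononSlackCertificatesNearFarGlueRSupercell
import Summits.AtomisticToContinuum.Crystallization.Theorems.PhononSlackCertificatesNearFarGlueRTorusLoose
import Summits.AtomisticToContinuum.Crystallization.Theorems.ThreeConeCertificateOnePercentCertificateFccRung
import Literature.MathematicalPhysics.StatisticalMechanics.PeriodicConfigurationSums
import Literature.MathematicalPhysics.StatisticalMechanics.MuGroundStateConfiguration
import Literature.Geometry.DiscreteGeometry.TwoShellPatterns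

/-!
# Crux `PhononSlackCertificates.NearFarGlueR` (stmt-AtomisticToContinuum-14970), line `Sketch`:
periodic Lennard-Jones GROUND STATES are `3/10`-separated — hence, under the residual, contact-free

Continuation lead c6.  The near-minimiser file (`…NearFarGlueRNearMin.lean`) drew the necessary
condition "under the residual a periodic ground state with `3/10`-separated point set has no tight
contact".  Here the separation hypothesis is REMOVED: every periodic configuration realising the
periodic infimum `e*` has a `3/10`-separated point set (`separated_of_periodicMinimiser`).  Proof:
a closest pair `(u, v)` at distance `d < 3/10` exists (local finiteness, §1); every other point is
`≥ d` from `u` and the points are pairwise `≥ d` apart, so the site sum of `u` is at least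
`d⁻¹²/12 − (250/6)·d⁻⁶ > 0` (shell bound `sum_inv_pow_six_le_of_le_dist`, §2); re-presenting the
configuration on a supercell `R·Λ` (`exists_supercell`: same points, same energy, periods `≥ 9/10`,
`u` and `v` in different orbits) the c5 torus strip `eStar_add_le_of_loose` removes the orbit of
`u` and improves on `e(P) = e*` — impossible (§3).  Consequently (§4) under the residual EVERY
periodic ground state is tight-contact-free (`forall_not_tight_of_periodicMinimiser'`).  All
`[folklore]`.
-/

noncomputable section

namespace Summit.AtomisticToContinuum.Crystallization.Theorems.PhononSlackCertificatesNearFarGlueR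

open Literature.MathematicalPhysics.StatisticalMechanics
open Literature.Geometry.DiscreteGeometry
open Summit.AtomisticToContinuum.Crystallization.Theses.PhononSlackCertificates
open scoped BigOperators Classical
open Filter Topology

/-! ## §1 A closest pair exists -/

/-- **A closest pair below `3/10` exists.**  If a periodic configuration has two distinct points
at distance `< 3/10`, it has a pair of distinct points at distance `< 3/10` that is minimal among
ALL pairs of distinct points (only finitely many points lie within `3/10` of a motif point, and
every pair is a lattice translate of a pair whose first member is a motif point). [folklore] -/
theorem exists_closest_pair (P : PeriodicConfiguration 3)
    (h : ∃ u ∈ P.points, ∃ v ∈ P.points, u ≠ v ∧ dist u v < 3 / 10) :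
    ∃ u ∈ P.points, ∃ v ∈ P.points, u ≠ v ∧ dist u v < 3 / 10 ∧
      ∀ p ∈ P.points, ∀ q ∈ P.points, p ≠ q → dist u v ≤ dist p q := by
  -- the finite set of close pairs with first member in the motif
  let T : Set (EuclideanSpace ℝ (Fin 3) × EuclideanSpace ℝ (Fin 3)) :=
    {pq | pq.1 ∈ P.motif ∧ pq.2 ∈ P.points ∧ pq.2 ≠ pq.1 ∧ dist pq.1 pq.2 ≤ 3 / 10}
  have hTfin : T.Finite := by
    have hbig : T ⊆ ⋃ y ∈ (P.motif : Set (EuclideanSpace ℝ (Fin 3))),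
        (fun q => (y, q)) '' (Metric.closedBall y (3 / 10) ∩ P.points) := by
      rintro ⟨y, q⟩ ⟨hy, hq, -, hd⟩
      refine Set.mem_iUnion₂.2 ⟨y, hy, q, ⟨?_, hq⟩, rfl⟩
      rw [Metric.mem_closedBall, dist_comm]; exact hd
    refine Set.Finite.subset ?_ hbig
    refine Set.Finite.biUnion P.motif.finite_toSet fun y _ => Set.Finite.image _ ?_
    exact P.finite_inter_points Metric.isBounded_closedBall
  -- reduction of an arbitrary close pair to one with first member in the motif
  have hred : ∀ p ∈ P.points, ∀ q ∈ P.points, p ≠ q → dist p q ≤ 3 / 10 →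
      ∃ pq ∈ T, dist pq.1 pq.2 = dist p q := by
    intro p hp q hq hpq hd
    obtain ⟨y, hy, g, hg, rfl⟩ := hp
    refine ⟨(y, q - g), ⟨hy, ?_, ?_, ?_⟩, ?_⟩
    · simpa [sub_eq_add_neg] using P.add_mem_points hq (P.lattice.neg_mem hg)
    · intro h'; apply hpq; simp only at h'; rw [← h', sub_add_cancel]
    · simp only
      have : dist y (q - g) = dist (y + g) q := by
        rw [dist_eq_norm, dist_eq_norm]; congr 1; abel
      rw [this]; exact hd
    · show dist y (q - g) = dist (y + g) q
      rw [dist_eq_norm, dist_eq_norm]; congr 1; abel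
  obtain ⟨u, hu, v, hv, huv, hduv⟩ := h
  have hTne : T.Nonempty := by
    obtain ⟨pq, hpq, -⟩ := hred u hu v hv huv hduv.le
    exact ⟨pq, hpq⟩
  obtain ⟨⟨a, b⟩, ⟨ha, hb, hba, hdab⟩, hmin⟩ :=
    T.exists_min_image (fun pq => dist pq.1 pq.2) hTfin hTne
  refine ⟨a, P.mem_points_of_mem_motif ha, b, hb, fun h' => hba h'.symm, ?_, fun p hp q hq hpq => ?_⟩
  · obtain ⟨pq, hpq, hdeq⟩ := hred u hu v hv huv hduv.le
    have := hmin pq hpq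
    simp only at this
    linarith
  · by_cases hd : dist p q ≤ 3 / 10
    · obtain ⟨pq, hpq, hdeq⟩ := hred p hp q hq hpq hd
      have := hmin pq hpq
      simp only at this
      linarith
    · exact le_trans hdab (not_le.1 hd).le

/-! ## §2 The site sum of a closest-pair point is positive -/

/-- **Shell bound for the `r⁻⁶` sum of a separated periodic point set about one of its points.**
If all points other than `u` are pairwise `≥ d` apart and `≥ d` from `u` (`d > 0`), then
`Σ'_{q ≠ u} |u − q|⁻⁶ ≤ 250·d⁻⁶` (finite partial sums by `sum_inv_pow_six_le_of_le_dist`).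
[folklore] -/
theorem tsum_inv_pow_six_le_of_sep (P : PeriodicConfiguration 3) {u : EuclideanSpace ℝ (Fin 3)}
    {d : ℝ} (hd : 0 < d)
    (hfar : ∀ q ∈ P.points, q ≠ u → d ≤ dist u q)
    (hsep : ∀ p ∈ P.points, ∀ q ∈ P.points, p ≠ q → d ≤ dist p q) :
    (∑' q : {q : EuclideanSpace ℝ (Fin 3) // q ∈ P.points ∧ q ≠ u}, (dist u q.1)⁻¹ ^ 6) ≤
      250 * d⁻¹ ^ 6 := by
  have hsum := P.summable_inv_pow_six_dist (by norm_num) u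
  refine hsum.tsum_le_of_sum_le fun s => ?_
  -- the partial sum over `s` is a finite shell sum
  have hinj : Set.InjOn (fun q : {q : EuclideanSpace ℝ (Fin 3) // q ∈ P.points ∧ q ≠ u} => q.1) ↑s :=
    fun a _ b _ h => Subtype.ext h
  -- (import note: `MuGroundStateConfiguration`, not `MuGSC` — both declare `UniformlyDiscrete`, and the
  -- torus files of this line already import the former)
  have key := sum_inv_pow_six_le_of_forall_le_dist (s.image fun q => q.1) u hd
    (fun z hz => by
      obtain ⟨q, -, rfl⟩ := Finset.mem_image.1 hz
      exact hfar q.1 q.2.1 q.2.2)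
    (fun z hz w hw hzw => by
      obtain ⟨q, -, rfl⟩ := Finset.mem_image.1 hz
      obtain ⟨q', -, rfl⟩ := Finset.mem_image.1 hw
      exact hsep q.1 q.2.1 q'.1 q'.2.1 hzw)
  rw [Finset.sum_image hinj] at key
  exact key

/-- **The site sum of a closest-pair point is positive.**  If `v ≠ u` are points at distance
`d < 3/10` and `d` is minimal among all pairs of distinct points, then
`Σ'_{q ≠ u} V_LJ(|u − q|) ≥ d⁻¹²/12 − (250/6)·d⁻⁶ > 0`. [folklore] -/
theorem site_sum_pos_of_closest (P : PeriodicConfiguration 3) {u v : EuclideanSpace ℝ (Fin 3)}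
    (hu : u ∈ P.points) (hv : v ∈ P.points) (huv : u ≠ v) (hd : dist u v < 3 / 10)
    (hmin : ∀ p ∈ P.points, ∀ q ∈ P.points, p ≠ q → dist u v ≤ dist p q) :
    0 < ∑' q : {q : EuclideanSpace ℝ (Fin 3) // q ∈ P.points ∧ q ≠ u}, lennardJones (dist u q.1) := by
  set d := dist u v with hd_def
  have hdpos : 0 < d := dist_pos.2 huv
  have h6 := P.summable_inv_pow_six_dist (by norm_num) u
  have h12 : Summable fun q : {q : EuclideanSpace ℝ (Fin 3) // q ∈ P.points ∧ q ≠ u} =>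
      (dist u q.1)⁻¹ ^ 12 := P.summable_inv_pow_dist (by norm_num) u
  -- split the Lennard-Jones sum
  have hsplit : (∑' q : {q : EuclideanSpace ℝ (Fin 3) // q ∈ P.points ∧ q ≠ u}, lennardJones (dist u q.1)) =
      (1 / 12) * (∑' q : {q : EuclideanSpace ℝ (Fin 3) // q ∈ P.points ∧ q ≠ u}, (dist u q.1)⁻¹ ^ 12) -
        (1 / 6) * (∑' q : {q : EuclideanSpace ℝ (Fin 3) // q ∈ P.points ∧ q ≠ u}, (dist u q.1)⁻¹ ^ 6) := by
    rw [← tsum_mul_left, ← tsum_mul_left, ← (h12.mul_left _).tsum_sub (h6.mul_left _)]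
    rfl
  -- the repulsive part is at least the term of `v`
  have hrep : (dist u v)⁻¹ ^ 12 ≤
      ∑' q : {q : EuclideanSpace ℝ (Fin 3) // q ∈ P.points ∧ q ≠ u}, (dist u q.1)⁻¹ ^ 12 := by
    have := h12.le_tsum ⟨v, hv, huv.symm⟩ (fun q _ => by positivity)
    simpa using this
  -- the attractive part is at most `250 d⁻⁶`
  have hatt := tsum_inv_pow_six_le_of_sep P hdpos
    (fun q hq hqu => by rw [hd_def]; exact hmin u hu q hq (Ne.symm hqu))
    (fun p hp q hq hpq => by rw [hd_def]; exact hmin p hp q hq hpq)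
  -- numerics: `t = d⁻⁶ ≥ (10/3)⁶ > 500`
  have ht : (500 : ℝ) < (dist u v)⁻¹ ^ 6 := by
    have h1 : (10 / 3 : ℝ) < (dist u v)⁻¹ := by
      rw [show (10 / 3 : ℝ) = (3 / 10)⁻¹ by norm_num]
      exact (inv_lt_inv₀ (by norm_num) hdpos).2 hd
    have h2 : (10 / 3 : ℝ) ^ 6 < (dist u v)⁻¹ ^ 6 := by gcongr
    nlinarith
  have hsq : ((dist u v)⁻¹ ^ 6) ^ 2 = (dist u v)⁻¹ ^ 12 := by ring
  rw [hsplit]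
  nlinarith [hrep, hatt, ht, hsq]

/-! ## §3 Periodic ground states are `3/10`-separated -/

/-- **Periodic Lennard-Jones ground states are `3/10`-separated.**  If a periodic configuration
`P` realises the periodic infimum, `e(P) = e* = inf_Q e(Q)`, then any two distinct points of `P`
are at distance `≥ 3/10`.  (Closest pair `(u, v)` at `d < 3/10`; supercell `R·Λ` with `R·d ≥ 9/10`
and `R ≥ 2` — same points, same energy, `u` and `v` in different orbits; the orbit of `u` is LOOSE
(site sum `> 0 > e*`), so the torus strip `eStar_add_le_of_loose` improves on `e*`.) [folklore] -/
theorem separated_of_periodicMinimiser (P : PeriodicConfiguration 3)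
    (hleast : IsLeast (Set.range fun Q : PeriodicConfiguration 3 => Q.energyPerParticle lennardJones)
      (P.energyPerParticle lennardJones)) :
    ∀ u ∈ P.points, ∀ v ∈ P.points, u ≠ v → (3 / 10 : ℝ) ≤ dist u v := by
  by_contra hcon
  push Not at hcon
  obtain ⟨u₀, hu₀, v₀, hv₀, huv₀, hd₀⟩ := hcon
  obtain ⟨u, hu, v, hv, huv, hduv, hmin⟩ := exists_closest_pair P ⟨u₀, hu₀, v₀, hv₀, huv₀, hd₀⟩
  set d := dist u v with hd_def
  have hdpos : 0 < d := dist_pos.2 huv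
  have heP : P.energyPerParticle lennardJones =
      (⨅ Q : PeriodicConfiguration 3, Q.energyPerParticle lennardJones) := hleast.csInf_eq.symm
  -- non-zero periods have norm `≥ d`
  have hperΛ : ∀ g ∈ P.lattice, g ≠ 0 → d ≤ ‖g‖ := by
    intro g hg hne
    have h1 : u + g ∈ P.points := P.add_mem_points hu hg
    have h2 : u ≠ u + g := by intro h; exact hne (by simpa using h.symm)
    have := hmin u hu (u + g) h1 h2
    rwa [dist_eq_norm, show u - (u + g) = -g by abel, norm_neg] at this
  -- the supercell factor `R` with `R d ≥ 9/10`, `R ≥ 2`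
  obtain ⟨R₀, hR₀⟩ : ∃ R₀ : ℕ, (9 / 10) / d ≤ R₀ := exists_nat_ge _
  let R : ℕ := R₀ + 2
  haveI : NeZero R := ⟨by omega⟩
  have hRge : (9 / 10) / d ≤ (R : ℝ) := hR₀.trans (by simp [R])
  have hR2 : (2 : ℝ) ≤ R := by simp [R]
  have hRpos : (0 : ℝ) < R := by linarith
  obtain ⟨P', hpts, hE, hlat, -⟩ := exists_supercell P R
  have hper' : ∀ g' ∈ P'.lattice, g' ≠ 0 → (9 / 10 : ℝ) ≤ ‖g'‖ ∧ 2 * d ≤ ‖g'‖ := by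
    intro g' hg' hne
    obtain ⟨g₀, hg₀, rfl⟩ := (hlat g').1 hg'
    have hg₀ne : g₀ ≠ 0 := by rintro rfl; exact hne (smul_zero _)
    have hn := hperΛ g₀ hg₀ hg₀ne
    rw [norm_smul, Real.norm_of_nonneg hRpos.le]
    constructor
    · have : 9 / 10 ≤ (R : ℝ) * d := by rwa [div_le_iff₀ hdpos] at hRge
      nlinarith
    · nlinarith
  have hsub' : ∀ g' ∈ P'.lattice, g' ∈ P.lattice := by
    intro g' hg'
    obtain ⟨g₀, hg₀, rfl⟩ := (hlat g').1 hg'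
    have : ((R : ℕ) : ℝ) • g₀ = ((R : ℕ) : ℤ) • g₀ := by
      rw [Nat.cast_smul_eq_nsmul, natCast_zsmul]
    rw [this]; exact P.lattice.smul_mem _ hg₀
  -- representatives of `u` and `v` in the motif of `P'`
  have hu' : u ∈ P'.points := by rw [hpts]; exact hu
  have hv' : v ∈ P'.points := by rw [hpts]; exact hv
  obtain ⟨w, hw, g', hg', rfl⟩ := hu'
  obtain ⟨w₂, hw₂, g₂, hg₂, rfl⟩ := hv'
  have hww₂ : w ≠ w₂ := by
    intro h
    subst h
    have hmem : g' - g₂ ∈ P'.lattice := P'.lattice.sub_mem hg' hg₂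
    have hne : g' - g₂ ≠ 0 := by
      intro h0; apply huv; rw [sub_eq_zero] at h0; rw [h0]
    have h2d := (hper' _ hmem hne).2
    have : dist (w + g') (w + g₂) = ‖g' - g₂‖ := by
      rw [dist_eq_norm]; congr 1; abel
    rw [← this, ← hd_def] at h2d
    linarith
  have h2 : 2 ≤ P'.motif.card := by
    have : 1 < P'.motif.card := Finset.one_lt_card.2 ⟨w, hw, w₂, hw₂, hww₂⟩
    omega
  -- the site sum of the orbit of `u` in `P'` is the site sum of `u` in `P`, hence positive
  have hsite : (∑' q : {q : EuclideanSpace ℝ (Fin 3) // q ∈ P'.points ∧ q ≠ w}, lennardJones (dist w q.1)) =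
      ∑' q : {q : EuclideanSpace ℝ (Fin 3) // q ∈ P.points ∧ q ≠ w + g'}, lennardJones (dist (w + g') q.1) := by
    rw [hpts]
    exact (tsum_site_eq_of_mem_lattice P lennardJones w (hsub' g' hg')).symm
  have hpos : 0 < ∑' q : {q : EuclideanSpace ℝ (Fin 3) // q ∈ P'.points ∧ q ≠ w}, lennardJones (dist w q.1) := by
    rw [hsite]
    exact site_sum_pos_of_closest P hu hv huv hduv hmin
  -- strip the loose orbit: `e* + (B − e(P'))/(n−1) ≤ e(P') = e*`
  set B := ∑' q : {q : EuclideanSpace ℝ (Fin 3) // q ∈ P'.points ∧ q ≠ w}, lennardJones (dist w q.1) with hB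
  have hloose := eStar_add_le_of_loose P' hw h2 (fun g hg hne => (hper' g hg hne).1)
    (G := B - P'.energyPerParticle lennardJones) (by linarith)
  rw [hE lennardJones, heP] at hloose
  have hn : (0 : ℝ) < (P'.motif.card : ℝ) - 1 := by
    have : (2 : ℝ) ≤ P'.motif.card := by exact_mod_cast h2
    linarith
  have hG : B - (⨅ Q : PeriodicConfiguration 3, Q.energyPerParticle lennardJones) ≤ 0 := by
    by_contra hG
    have hG : 0 < B - (⨅ Q : PeriodicConfiguration 3, Q.energyPerParticle lennardJones) := not_le.1 hG
    have : 0 < (B - (⨅ Q : PeriodicConfiguration 3, Q.energyPerParticle lennardJones)) /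
        ((P'.motif.card : ℝ) - 1) := div_pos hG hn
    linarith
  -- but `e* ≤ −0.711 < 0 < B`
  have heneg : (⨅ Q : PeriodicConfiguration 3, Q.energyPerParticle lennardJones) ≤ -(711 / 1000) :=
    OnePercentFccRung.eStar_le_neg
  linarith

/-- **Registered sub-goal `stub_minimiserSep` of the line `Sketch`** (the statement of
`separated_of_periodicMinimiser`). [folklore] -/
theorem stub_minimiserSep :
    ∀ P : PeriodicConfiguration 3,
      IsLeast (Set.range fun Q : PeriodicConfiguration 3 => Q.energyPerParticle lennardJones)
        (P.energyPerParticle lennardJones) →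
      ∀ u ∈ P.points, ∀ v ∈ P.points, u ≠ v → (3 / 10 : ℝ) ≤ dist u v :=
  separated_of_periodicMinimiser

/-! ## §4 Under the residual every periodic ground state is tight-contact-free -/

/-- **Necessary condition of the residual, hypothesis-free form**: if one `g > 0` charges every
periodic configuration with `3/10`-separated point set `g` per tight contact per cell (the torus
form of the residual), then in every periodic GROUND STATE no bad point lies within `21/20` of a
good point. [folklore] -/
theorem forall_not_tight_of_periodicMinimiser'
    (H : ∃ g : ℝ, 0 < g ∧ ∀ P : PeriodicConfiguration 3,
      (∀ u ∈ P.points, ∀ v ∈ P.points, u ≠ v → (3 / 10 : ℝ) ≤ dist u v) →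
      (⨅ Q : PeriodicConfiguration 3, Q.energyPerParticle lennardJones)
        + g * ((P.motif.filter fun y => ¬ IsTwoShellGoodSet (1 / 20) (47 / 50) 1 P.points y ∧
            ∃ z ∈ P.points, IsTwoShellGoodSet (1 / 20) (47 / 50) 1 P.points z ∧
              dist z y ≤ 21 / 20).card : ℝ) / (P.motif.card : ℝ)
        ≤ P.energyPerParticle lennardJones)
    (P : PeriodicConfiguration 3)
    (hleast : IsLeast (Set.range fun Q : PeriodicConfiguration 3 => Q.energyPerParticle lennardJones)
      (P.energyPerParticle lennardJones)) :
    ∀ y ∈ P.points, ¬ IsTwoShellGoodSet (1 / 20) (47 / 50) 1 P.points y →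
      ∀ z ∈ P.points, IsTwoShellGoodSet (1 / 20) (47 / 50) 1 P.points z → (21 / 20 : ℝ) < dist z y :=
  forall_not_tight_of_periodicMinimiser H P (separated_of_periodicMinimiser P hleast) hleast

end Summit.AtomisticToContinuum.Crystallization.Theorems.PhononSlackCertificatesNearFarGlueR

end
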